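import Summits.BirchSwinnertonDyer.BirchSwinnertonDyer.Theorems.RamifiedHeegnerPairTwistUnitIntrinsic
import HarnessLib

/-!
# The twist-unit datum / U₁ / BSD₃ at intrinsic Gss2 rank-one curves — part B: `205128l2`, `182853c1`, `250065g1`

Continuation of `…Theorems.RamifiedHeegnerPairTwistUnitIntrinsic` (seat `bsd-trib-w-rhp` g11; the doors `twistUnitFieldAt_of_sqrtField{_of_odd}`
and the honest framing are there): per curve `tu_at_<label> : … → SchneiderFree.Upper.TwistUnitFieldAt W 3`
(KERNEL field / Heegner hypothesis / twist identity / minimality; DISPLAYED `hN`, `hLt`, `hqd`/`hvd`), `u1_at_<label> : … → MissingUpperBoundAt W 3` by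
rhp-p2 g7 §3 `leafRankOneUpper_three_tamFree_of_print_of_twistUnit` (∏c_ℓ, ¬CM, Addv ∧ SubGss in the kernel; seven PRINTED facts + `hr`, `Dt`/`hc` displayed),
`bsd3_at_<label> : … → BSDp W 3` with g8's lower half. **Helper instances `--supports` U₁ (26022); nothing booked; no item closed; BSD is not proved
for any curve by this file.** [cite: MatarNekovar2019, Thm. 0.7 (p. 456)] [cite: GrossZagier1986, Thm. I.(6.3) and (7.3)] [cite: KrizLi2019, Thm. 1.20]
[cite: Silverman1994, IV.9.4] [cite: Cremona2006, Table 1]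
-/

set_option linter.dupNamespace false
set_option autoImplicit false

noncomputable section

open scoped Classical NumberField

open WeierstrassCurve NumberField IsDedekindDomain IsDedekindDomain.HeightOneSpectrum Rat.HeightOneSpectrum Field
  Literature Literature.NumberTheory.DiophantineGeometry Literature.NumberTheory.EllipticCurves
  Literature.NumberTheory.EllipticCurves.ModularForms Literature.NumberTheory.EllipticCurves.Rank1Residual
  Literature.NumberTheory.EllipticCurves.Rank1Residual.Typed Literature.NumberTheory.Automorphic
  Literature.NumberTheory.EllipticCurves.Rank1Residual.X11RankOneCertificates
  Literature.NumberTheory.EllipticCurves.KrizLi2019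
  Literature.NumberTheory.GaloisRepresentations Literature.NumberTheory.QuadraticFields
  Summit.BirchSwinnertonDyer.BirchSwinnertonDyer.Rank1Residual.IntModel
  Summit.BirchSwinnertonDyer.BirchSwinnertonDyer.Rank2Observatory.Tam
  Summit.BirchSwinnertonDyer.Rank1Residual Summit.BirchSwinnertonDyer.Rank1Residual.Additive
  Summit.BirchSwinnertonDyer.Rank1Residual.X11b Summit.BirchSwinnertonDyer.Rank1Residual.X11b.Three
  Summit.BirchSwinnertonDyer.Rank1Residual.GaloisImage Summit.BirchSwinnertonDyer.Rank1Residual.Supersingular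
  Summit.BirchSwinnertonDyer.BirchSwinnertonDyer.Theses.RamifiedHeegnerPair
  Summit.BirchSwinnertonDyer.BirchSwinnertonDyer.Theorems
  Summit.BirchSwinnertonDyer.BirchSwinnertonDyer.Theorems.SchneiderFree
  Summit.BirchSwinnertonDyer.BirchSwinnertonDyer.Theorems.RamifiedPairUpperBound
  Summit.BirchSwinnertonDyer.BirchSwinnertonDyer.Theorems.RamifiedHeegnerPairStepLIntrinsic
  Summit.BirchSwinnertonDyer.BirchSwinnertonDyer.Theorems.AdditiveBranchIMCGordTwoRankOne.HeegnerKolyvagin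

namespace Summit.BirchSwinnertonDyer.BirchSwinnertonDyer.Theorems.RamifiedHeegnerPairTwistUnitIntrinsic

/-! ## §3 `205128l2` = `[0, 0, 0, -2285741979, -42061737232170]`, `N = 205128 = 2^3·3^2·7·11·37`, `K = ℚ(√-887)`, `Wd = [0, 0, 0, -1798350931075851, 29353376524150019793510]` (`N(Wd) = 161388351432`, `∏c(Wd) = 32`, `#Wd(ℚ)_tors = 2`, `#Ш(Wd)_an = 100`; `L(E^{(-887)},1) = 1.7926016266`) -/

/-- **THE TWIST-UNIT DATUM AT `205128l2` over `K = ℚ(√-887)`** — `SchneiderFree.Upper.TwistUnitFieldAt W 3` at `W = E`, member `W₂ = E`. KERNEL: the field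
(`sqrtField (-887)`, imaginary quadratic, `d_K = -887` odd), the Heegner hypothesis at `N = 205128` (`-887 ≡ 1 (mod 8)`, `(-887/ℓ) = 1` at the odd `ℓ ∣ N`),
Kraus minimality of `Wd` (`isGloballyMinimal_sWd205128l2`, by name), the twist identity `Cd • E^{(-887)} = Wd` with `Cd = [1, 0, 0, 0]`. DISPLAYED: Cremona's
`N(E) = 205128` (`hN`), `L(E^{(-887)},1) = 1.7926016266 ≠ 0` (`hLt`, PARI `ellL1` = `lfun`), `#Ш(Wd)_an = 100` (`hqd`/`hvd`; g9 kit j304074, g11 TU census).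
A per-curve certificate of the research statement TU₁; nothing booked; BSD is not proved by this. [cite: KrizLi2019, Thm. 1.20]
[cite: GrossZagier1986, Thm. I.(6.3)] [cite: Cremona2006, Table 1 (Cremona label 205128l2)] -/
theorem tu_at_205128l2 {W : WeierstrassCurve ℚ} [W.IsElliptic] [W.IsGloballyMinimal] (hWeq : W = (⟨0, 0, 0, -2285741979, -42061737232170⟩ : WeierstrassCurve ℚ))
    (hN : W.conductorNorm ℤ = 205128) (hLt : (W.quadraticTwist ((-887 : ℤ) : ℚ)).entireLFunction 1 ≠ 0)
    {qd : ℚ} (hqd : haveI := isElliptic_sWd205128l2; shaAn (⟨0, 0, 0, -1798350931075851, 29353376524150019793510⟩ : WeierstrassCurve ℚ) = (qd : ℂ)) (hvd : padicValRat 3 qd ≤ 0) :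
    Upper.TwistUnitFieldAt W 3 := by
  subst hWeq
  haveI := isElliptic_sWd205128l2; haveI := isGloballyMinimal_sWd205128l2
  haveI : Fact ((-887 : ℤ) < 0) := ⟨by norm_num⟩
  have hjac : ∀ ℓ : ℕ, ℓ.Prime → ℓ ∣ 205128 → ℓ ≠ 2 → jacobiSym (-887) ℓ = 1 := by
    intro ℓ hℓ hℓN hℓ2
    have hmem : ℓ ∈ Nat.primeFactors 205128 := Nat.mem_primeFactors.mpr ⟨hℓ, hℓN, by norm_num⟩
    have hpf : Nat.primeFactors 205128 = {2, 3, 7, 11, 37} := by decide +kernel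
    rw [hpf] at hmem
    simp only [Finset.mem_insert, Finset.mem_singleton] at hmem
    rcases hmem with rfl | rfl | rfl | rfl | rfl
    · exact absurd rfl hℓ2
    all_goals norm_num
  have hWd : (⟨1, (0 : ℚ), (0 : ℚ), (0 : ℚ)⟩ : VariableChange ℚ) •
      (⟨0, 0, 0, -2285741979, -42061737232170⟩ : WeierstrassCurve ℚ).quadraticTwist ((-887 : ℤ) : ℚ) = (⟨0, 0, 0, -1798350931075851, 29353376524150019793510⟩ : WeierstrassCurve ℚ) := by
    push_cast
    ext <;> simp [WeierstrassCurve.variableChange_a₁, WeierstrassCurve.variableChange_a₂,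
      WeierstrassCurve.variableChange_a₃, WeierstrassCurve.variableChange_a₄, WeierstrassCurve.variableChange_a₆,
      WeierstrassCurve.quadraticTwist, WeierstrassCurve.b₂, WeierstrassCurve.b₄, WeierstrassCurve.b₆] <;> norm_num
  exact twistUnitFieldAt_of_sqrtField _ 3 205128 (-887) (by norm_num)
    (by rw [show (-887 : ℤ).natAbs = 887 by rfl, Nat.squarefree_iff_nodup_primeFactorsList (by norm_num)]; simp)
    hjac hN hLt _ _ hWd hqd hvd

/-- Row certificate of `205128l2 = [0, 0, 0, -2285741979, -42061737232170]` (stage-1 `TamLocal` at every bad prime — `2`: II*, `c = 1`; `3`: I0*, `c = 4`; `7`: In, `c = 2`; `11`: In, `c = 1`; `37`: In, `c = 1` — and the stage-3 `TamZ` entry making the `I₀*` prime `3`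
exact): checks in the kernel. Emitted by n1011-p03 `tools/tamcert.py` = rank-2 observatory engine 1, unchanged. [cite: Silverman1994, IV.9.4 Steps 2–7]
[cite: Tate1975, §7] [cite: Cremona2006, Table 1 (Cremona label 205128l2)] -/
theorem tamRowZ_205128l2 :
    TamZ.rowCheckZ [⟨2, 1, 5, 0, 3, 1, 8, 11, 10, 0, 1⟩, ⟨3, 1, 5, 0, 0, 0, 0, 6, 6, 0, 4⟩, ⟨7, 2, 3, 0, 0, 0, 0, 14, 0, 0, 2⟩, ⟨11, 3, 3, 0, 0, 0, 0, 5, 0, 0, 1⟩, ⟨37, 6, 3, 0, 0, 0, 0, 1, 0, 0, 1⟩] [] [⟨3, 9, 0, 0, 0, 6, 0, 3⟩] (⟨0, 0, 0, -2285741979, -42061737232170⟩ : WeierstrassCurve ℤ) = true := by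
  decide +kernel

/-- **`∏_ℓ c_ℓ(205128l2) = 8` IN THE KERNEL** for any globally minimal `W / ℚ` with this integral model (Cremona's column: `8`; so `3 ∤ ∏ c_ℓ`).
[cite: Silverman1994, IV.9.4] [cite: Cremona2006, Table 1 (Cremona label 205128l2)] -/
theorem tamagawaProduct_205128l2 {W : WeierstrassCurve ℚ} [W.IsGloballyMinimal]
    (hI : integralModelInt W = (⟨0, 0, 0, -2285741979, -42061737232170⟩ : WeierstrassCurve ℤ)) : W.tamagawaProduct = 8 :=
  (IntModelTam.tamagawaProduct_eq_rowValueZ_of_intModel hI tamRowZ_205128l2 (by decide +kernel)).trans (by decide +kernel)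

/-- **U₁ AT `205128l2` BY THE TWIST-UNIT ROAD** — `MissingUpperBoundAt W 3` (`ord₃ #Ш(E) ≤ ord₃ #Ш(E)_an`) at `W = E` from rhp-p2 g7 §3
`leafRankOneUpper_three_tamFree_of_print_of_twistUnit`: PRINTED binders `hGZ hKo hGZK hmod hGZ73 hMN hCassels` (Gross–Zagier ∀, Kolyvagin ∀, GZK,
Version L, GZ I.(7.3), Matar–Nekovář 2019 Thm 0.7 irreducible form, Cassels); KERNEL: `∏ c_ℓ(E) = 8` (NEW Tate certificate `tamagawaProduct_205128l2`), `¬ CM` (`j = c₄³/Δ` is none of the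
thirteen CM `j`-invariants, `hasCM_iff_j_mem_holds` + `norm_num`), `Addv ∧ SubGss` at `3` (`subGss_three_205128l2`), and everything kernel in `tu_at_205128l2`; DISPLAYED: `hN`, `hr` (`r_an(E) = 1`, Cremona),
the parametrisation datum `Dt` at level `N_E` with `3 ∤ c(Dt)` (`hc`; Manin constant `1` for this optimal curve, Cremona `manin.txt`), `hLt`, `hqd`/`hvd`.
NO S2, NO Σ, NO L₀, NO image hypothesis. Per curve; U₁ (26022) stays OPEN; BSD is not proved by this.
[cite: MatarNekovar2019, Thm. 0.7 (p. 456) and §0.11 (p. 457)] [cite: GrossZagier1986, Thm. I.(6.3) and (7.3)] [cite: Miller2011LMS, Def. 1.1]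
[cite: Cremona2006, Table 1 (Cremona label 205128l2)] -/
theorem u1_at_205128l2
    (hGZ : ∀ (N : ℕ) [NeZero N] (W : WeierstrassCurve ℚ) (K : Type) [Field K] [NumberField K], gross_zagier N W K)
    (hKo : ∀ (N : ℕ) [NeZero N] (W : WeierstrassCurve ℚ) (K : Type) [Field K] [NumberField K], kolyvagin N W K)
    (hGZK : rank_eq_analyticRank_of_analyticRank_le_one) (hmod : hasEntireLFunction_rat)
    (hGZ73 : GrossZagier1986_thm_I_7_3)
    (hMN : MatarNekovar2019.thm07_padicValNat_card_sha_primary_add_le_of_globalDivisibility_of_irreducible)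
    (hCassels : bsdRHS_eq_of_isIsogenous)
    {W : WeierstrassCurve ℚ} [W.IsElliptic] [W.IsGloballyMinimal] (hWeq : W = (⟨0, 0, 0, -2285741979, -42061737232170⟩ : WeierstrassCurve ℚ))
    (hN : W.conductorNorm ℤ = 205128) [NeZero (W.conductorNorm ℤ)] (hr : W.analyticRank = 1)
    (Dt : ModularParametrizationData W (W.conductorNorm ℤ)) (hc : ¬ (3 : ℤ) ∣ Dt.c)
    (hLt : (W.quadraticTwist ((-887 : ℤ) : ℚ)).entireLFunction 1 ≠ 0)
    {qd : ℚ} (hqd : haveI := isElliptic_sWd205128l2; shaAn (⟨0, 0, 0, -1798350931075851, 29353376524150019793510⟩ : WeierstrassCurve ℚ) = (qd : ℂ)) (hvd : padicValRat 3 qd ≤ 0) :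
    MissingUpperBoundAt W 3 := by
  have hTU : Upper.TwistUnitFieldAt W 3 := tu_at_205128l2 hWeq hN hLt hqd hvd
  subst hWeq
  have hI : integralModelInt (⟨0, 0, 0, -2285741979, -42061737232170⟩ : WeierstrassCurve ℚ) = (⟨0, 0, 0, -2285741979, -42061737232170⟩ : WeierstrassCurve ℤ) :=
    integralModelInt_eq_of_map_eq _ (map_mk_int 0 0 0 (-2285741979) (-42061737232170))
  have htam : ¬ 3 ∣ (⟨0, 0, 0, -2285741979, -42061737232170⟩ : WeierstrassCurve ℚ).tamagawaProduct := by rw [tamagawaProduct_205128l2 hI]; norm_num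
  have hCM : ¬ (⟨0, 0, 0, -2285741979, -42061737232170⟩ : WeierstrassCurve ℚ).HasCM := fun hCM ↦ by
    have hj := (WeierstrassCurve.hasCM_iff_j_mem_holds (⟨0, 0, 0, -2285741979, -42061737232170⟩ : WeierstrassCurve ℚ)).1 hCM
    rw [WeierstrassCurve.j, Units.val_inv_eq_inv_val, WeierstrassCurve.coe_Δ'] at hj
    simp only [cmJInvariants, Finset.mem_insert, Finset.mem_singleton] at hj
    norm_num [WeierstrassCurve.Δ, WeierstrassCurve.b₂, WeierstrassCurve.b₄, WeierstrassCurve.b₆, WeierstrassCurve.b₈,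
      WeierstrassCurve.c₄] at hj
  exact leafRankOneUpper_three_tamFree_of_print_of_twistUnit hGZ hKo hGZK hmod hGZ73 hMN hCassels _ hCM subGss_three_205128l2.1 subGss_three_205128l2.2
    hr htam Dt hc hTU

/-- **BSD₃ AT `205128l2` modulo print and displayed numerics, by the twist-unit road** — `BSDp W 3` from `u1_at_205128l2` (upper half) and g8's LOWER half
`RamifiedHeegnerPairL1Intrinsic.lowerHalf_three_205128l2` (`9 ∣ #Ш(E)` by the rigorous 3-descent certificate `27 ∣ #Sel₃(E)`, displayed as `hSel`, with
`#Ш(E)_an = q`, `ord₃ q ≤ 2` displayed), glued by `Typed.missingPPartAt_of_lower_of_upper` + `Typed.bsdp_of_missingPPartAt` (GZK). Per curve, CONDITIONAL on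
every displayed input and the seven printed facts; nothing booked; BSD is not proved by this. [cite: Miller2011LMS, Def. 1.1] [cite: SchaeferStoll2004, Cor. 5.9]
[cite: MatarNekovar2019, Thm. 0.7 (p. 456)] [cite: Cremona2006, Table 1 (Cremona label 205128l2)] -/
theorem bsd3_at_205128l2
    (hGZ : ∀ (N : ℕ) [NeZero N] (W : WeierstrassCurve ℚ) (K : Type) [Field K] [NumberField K], gross_zagier N W K)
    (hKo : ∀ (N : ℕ) [NeZero N] (W : WeierstrassCurve ℚ) (K : Type) [Field K] [NumberField K], kolyvagin N W K)
    (hGZK : rank_eq_analyticRank_of_analyticRank_le_one) (hmod : hasEntireLFunction_rat)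
    (hGZ73 : GrossZagier1986_thm_I_7_3)
    (hMN : MatarNekovar2019.thm07_padicValNat_card_sha_primary_add_le_of_globalDivisibility_of_irreducible)
    (hCassels : bsdRHS_eq_of_isIsogenous)
    {W : WeierstrassCurve ℚ} [W.IsElliptic] [W.IsGloballyMinimal] (hWeq : W = (⟨0, 0, 0, -2285741979, -42061737232170⟩ : WeierstrassCurve ℚ))
    (hN : W.conductorNorm ℤ = 205128) [NeZero (W.conductorNorm ℤ)] (hr : W.analyticRank = 1)
    {q : ℚ} (hq : shaAn W = (q : ℂ)) (hv : padicValRat 3 q ≤ 2) (hSel : 3 ^ 3 ∣ Nat.card (W.selmerGroup 3))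
    (Dt : ModularParametrizationData W (W.conductorNorm ℤ)) (hc : ¬ (3 : ℤ) ∣ Dt.c)
    (hLt : (W.quadraticTwist ((-887 : ℤ) : ℚ)).entireLFunction 1 ≠ 0)
    {qd : ℚ} (hqd : haveI := isElliptic_sWd205128l2; shaAn (⟨0, 0, 0, -1798350931075851, 29353376524150019793510⟩ : WeierstrassCurve ℚ) = (qd : ℂ)) (hvd : padicValRat 3 qd ≤ 0) :
    BSDp W 3 := by
  have hup : MissingUpperBoundAt W 3 := u1_at_205128l2 hGZ hKo hGZK hmod hGZ73 hMN hCassels hWeq hN hr Dt hc hLt hqd hvd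
  subst hWeq
  have hlow : MissingLowerBoundAt (⟨0, 0, 0, -2285741979, -42061737232170⟩ : WeierstrassCurve ℚ) 3 :=
    RamifiedHeegnerPairL1Intrinsic.lowerHalf_three_205128l2 hGZK hr hq hv hSel
  exact Typed.bsdp_of_missingPPartAt _ 3 hGZK hr.le (Typed.missingPPartAt_of_lower_of_upper _ 3 hlow hup)

/-! ## §4 `182853c1` = `[0, 0, 1, -522, -9187]`, `N = 182853 = 3^2·11·1847`, `K = ℚ(√-239)`, `Wd = [0, 0, 1, -29817162, 125416766873]` (`N(Wd) = 10444746213`, `∏c(Wd) = 4`, `#Wd(ℚ)_tors = 1`, `#Ш(Wd)_an = 4`; `L(E^{(-239)},1) = 1.0971237783`) -/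

/-- **THE TWIST-UNIT DATUM AT `182853c1` over `K = ℚ(√-239)`** — `SchneiderFree.Upper.TwistUnitFieldAt W 3` at `W = E`, member `W₂ = E`. KERNEL: the field
(`sqrtField (-239)`, imaginary quadratic, `d_K = -239` odd), the Heegner hypothesis at `N = 182853` (`-239 ≡ 1 (mod 8)`, `(-239/ℓ) = 1` at the odd `ℓ ∣ N`),
Kraus minimality of `Wd` (`isGloballyMinimal_sWd182853c1`, by name), the twist identity `Cd • E^{(-239)} = Wd` with `Cd = [1, 0, 0, 1/2)]`. DISPLAYED: Cremona's
`N(E) = 182853` (`hN`), `L(E^{(-239)},1) = 1.0971237783 ≠ 0` (`hLt`, PARI `ellL1` = `lfun`), `#Ш(Wd)_an = 4` (`hqd`/`hvd`; g9 kit j304074, g11 TU census).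
A per-curve certificate of the research statement TU₁; nothing booked; BSD is not proved by this. [cite: KrizLi2019, Thm. 1.20]
[cite: GrossZagier1986, Thm. I.(6.3)] [cite: Cremona2006, Table 1 (Cremona label 182853c1)] -/
theorem tu_at_182853c1 {W : WeierstrassCurve ℚ} [W.IsElliptic] [W.IsGloballyMinimal] (hWeq : W = (⟨0, 0, 1, -522, -9187⟩ : WeierstrassCurve ℚ))
    (hN : W.conductorNorm ℤ = 182853) (hLt : (W.quadraticTwist ((-239 : ℤ) : ℚ)).entireLFunction 1 ≠ 0)
    {qd : ℚ} (hqd : haveI := isElliptic_sWd182853c1; shaAn (⟨0, 0, 1, -29817162, 125416766873⟩ : WeierstrassCurve ℚ) = (qd : ℂ)) (hvd : padicValRat 3 qd ≤ 0) :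
    Upper.TwistUnitFieldAt W 3 := by
  subst hWeq
  haveI := isElliptic_sWd182853c1; haveI := isGloballyMinimal_sWd182853c1
  haveI : Fact ((-239 : ℤ) < 0) := ⟨by norm_num⟩
  have hjac : ∀ ℓ : ℕ, ℓ.Prime → ℓ ∣ 182853 → ℓ ≠ 2 → jacobiSym (-239) ℓ = 1 := by
    intro ℓ hℓ hℓN hℓ2
    have hmem : ℓ ∈ Nat.primeFactors 182853 := Nat.mem_primeFactors.mpr ⟨hℓ, hℓN, by norm_num⟩
    have hpf : Nat.primeFactors 182853 = {3, 11, 1847} := by decide +kernel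
    rw [hpf] at hmem
    simp only [Finset.mem_insert, Finset.mem_singleton] at hmem
    rcases hmem with rfl | rfl | rfl
    all_goals norm_num
  have hWd : (⟨1, (0 : ℚ), (0 : ℚ), ((1 : ℚ)/2)⟩ : VariableChange ℚ) •
      (⟨0, 0, 1, -522, -9187⟩ : WeierstrassCurve ℚ).quadraticTwist ((-239 : ℤ) : ℚ) = (⟨0, 0, 1, -29817162, 125416766873⟩ : WeierstrassCurve ℚ) := by
    push_cast
    ext <;> simp [WeierstrassCurve.variableChange_a₁, WeierstrassCurve.variableChange_a₂,
      WeierstrassCurve.variableChange_a₃, WeierstrassCurve.variableChange_a₄, WeierstrassCurve.variableChange_a₆,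
      WeierstrassCurve.quadraticTwist, WeierstrassCurve.b₂, WeierstrassCurve.b₄, WeierstrassCurve.b₆] <;> norm_num
  exact twistUnitFieldAt_of_sqrtField _ 3 182853 (-239) (by norm_num)
    (by rw [show (-239 : ℤ).natAbs = 239 by rfl, Nat.squarefree_iff_nodup_primeFactorsList (by norm_num)]; simp)
    hjac hN hLt _ _ hWd hqd hvd

/-- **U₁ AT `182853c1` BY THE TWIST-UNIT ROAD** — `MissingUpperBoundAt W 3` (`ord₃ #Ш(E) ≤ ord₃ #Ш(E)_an`) at `W = E` from rhp-p2 g7 §3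
`leafRankOneUpper_three_tamFree_of_print_of_twistUnit`: PRINTED binders `hGZ hKo hGZK hmod hGZ73 hMN hCassels` (Gross–Zagier ∀, Kolyvagin ∀, GZK,
Version L, GZ I.(7.3), Matar–Nekovář 2019 Thm 0.7 irreducible form, Cassels); KERNEL: `∏ c_ℓ(E) = 2` (k1 `tamagawaProduct_g182853c1` by name), `¬ CM` (`j = c₄³/Δ` is none of the
thirteen CM `j`-invariants, `hasCM_iff_j_mem_holds` + `norm_num`), `Addv ∧ SubGss` at `3` (`subGss_g182853c1_3`), and everything kernel in `tu_at_182853c1`; DISPLAYED: `hN`, `hr` (`r_an(E) = 1`, Cremona),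
the parametrisation datum `Dt` at level `N_E` with `3 ∤ c(Dt)` (`hc`; Manin constant `1` for this optimal curve, Cremona `manin.txt`), `hLt`, `hqd`/`hvd`.
NO S2, NO Σ, NO L₀, NO image hypothesis. Per curve; U₁ (26022) stays OPEN; BSD is not proved by this.
[cite: MatarNekovar2019, Thm. 0.7 (p. 456) and §0.11 (p. 457)] [cite: GrossZagier1986, Thm. I.(6.3) and (7.3)] [cite: Miller2011LMS, Def. 1.1]
[cite: Cremona2006, Table 1 (Cremona label 182853c1)] -/
theorem u1_at_182853c1
    (hGZ : ∀ (N : ℕ) [NeZero N] (W : WeierstrassCurve ℚ) (K : Type) [Field K] [NumberField K], gross_zagier N W K)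
    (hKo : ∀ (N : ℕ) [NeZero N] (W : WeierstrassCurve ℚ) (K : Type) [Field K] [NumberField K], kolyvagin N W K)
    (hGZK : rank_eq_analyticRank_of_analyticRank_le_one) (hmod : hasEntireLFunction_rat)
    (hGZ73 : GrossZagier1986_thm_I_7_3)
    (hMN : MatarNekovar2019.thm07_padicValNat_card_sha_primary_add_le_of_globalDivisibility_of_irreducible)
    (hCassels : bsdRHS_eq_of_isIsogenous)
    {W : WeierstrassCurve ℚ} [W.IsElliptic] [W.IsGloballyMinimal] (hWeq : W = (⟨0, 0, 1, -522, -9187⟩ : WeierstrassCurve ℚ))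
    (hN : W.conductorNorm ℤ = 182853) [NeZero (W.conductorNorm ℤ)] (hr : W.analyticRank = 1)
    (Dt : ModularParametrizationData W (W.conductorNorm ℤ)) (hc : ¬ (3 : ℤ) ∣ Dt.c)
    (hLt : (W.quadraticTwist ((-239 : ℤ) : ℚ)).entireLFunction 1 ≠ 0)
    {qd : ℚ} (hqd : haveI := isElliptic_sWd182853c1; shaAn (⟨0, 0, 1, -29817162, 125416766873⟩ : WeierstrassCurve ℚ) = (qd : ℂ)) (hvd : padicValRat 3 qd ≤ 0) :
    MissingUpperBoundAt W 3 := by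
  have hTU : Upper.TwistUnitFieldAt W 3 := tu_at_182853c1 hWeq hN hLt hqd hvd
  subst hWeq
  have hI : integralModelInt (⟨0, 0, 1, -522, -9187⟩ : WeierstrassCurve ℚ) = (⟨0, 0, 1, -522, -9187⟩ : WeierstrassCurve ℤ) :=
    integralModelInt_eq_of_map_eq _ (map_mk_int 0 0 1 (-522) (-9187))
  have htam : ¬ 3 ∣ (⟨0, 0, 1, -522, -9187⟩ : WeierstrassCurve ℚ).tamagawaProduct := by rw [tamagawaProduct_g182853c1 hI]; norm_num
  have hCM : ¬ (⟨0, 0, 1, -522, -9187⟩ : WeierstrassCurve ℚ).HasCM := fun hCM ↦ by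
    have hj := (WeierstrassCurve.hasCM_iff_j_mem_holds (⟨0, 0, 1, -522, -9187⟩ : WeierstrassCurve ℚ)).1 hCM
    rw [WeierstrassCurve.j, Units.val_inv_eq_inv_val, WeierstrassCurve.coe_Δ'] at hj
    simp only [cmJInvariants, Finset.mem_insert, Finset.mem_singleton] at hj
    norm_num [WeierstrassCurve.Δ, WeierstrassCurve.b₂, WeierstrassCurve.b₄, WeierstrassCurve.b₆, WeierstrassCurve.b₈,
      WeierstrassCurve.c₄] at hj
  exact leafRankOneUpper_three_tamFree_of_print_of_twistUnit hGZ hKo hGZK hmod hGZ73 hMN hCassels _ hCM subGss_g182853c1_3.1 subGss_g182853c1_3.2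
    hr htam Dt hc hTU

/-- **BSD₃ AT `182853c1` modulo print and displayed numerics, by the twist-unit road** — `BSDp W 3` from `u1_at_182853c1` (upper half) and g8's LOWER half
`RamifiedHeegnerPairL1Intrinsic.lowerHalf_three_182853c1` (`9 ∣ #Ш(E)` by the rigorous 3-descent certificate `27 ∣ #Sel₃(E)`, displayed as `hSel`, with
`#Ш(E)_an = q`, `ord₃ q ≤ 2` displayed), glued by `Typed.missingPPartAt_of_lower_of_upper` + `Typed.bsdp_of_missingPPartAt` (GZK). Per curve, CONDITIONAL on
every displayed input and the seven printed facts; nothing booked; BSD is not proved by this. [cite: Miller2011LMS, Def. 1.1] [cite: SchaeferStoll2004, Cor. 5.9]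
[cite: MatarNekovar2019, Thm. 0.7 (p. 456)] [cite: Cremona2006, Table 1 (Cremona label 182853c1)] -/
theorem bsd3_at_182853c1
    (hGZ : ∀ (N : ℕ) [NeZero N] (W : WeierstrassCurve ℚ) (K : Type) [Field K] [NumberField K], gross_zagier N W K)
    (hKo : ∀ (N : ℕ) [NeZero N] (W : WeierstrassCurve ℚ) (K : Type) [Field K] [NumberField K], kolyvagin N W K)
    (hGZK : rank_eq_analyticRank_of_analyticRank_le_one) (hmod : hasEntireLFunction_rat)
    (hGZ73 : GrossZagier1986_thm_I_7_3)
    (hMN : MatarNekovar2019.thm07_padicValNat_card_sha_primary_add_le_of_globalDivisibility_of_irreducible)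
    (hCassels : bsdRHS_eq_of_isIsogenous)
    {W : WeierstrassCurve ℚ} [W.IsElliptic] [W.IsGloballyMinimal] (hWeq : W = (⟨0, 0, 1, -522, -9187⟩ : WeierstrassCurve ℚ))
    (hN : W.conductorNorm ℤ = 182853) [NeZero (W.conductorNorm ℤ)] (hr : W.analyticRank = 1)
    {q : ℚ} (hq : shaAn W = (q : ℂ)) (hv : padicValRat 3 q ≤ 2) (hSel : 3 ^ 3 ∣ Nat.card (W.selmerGroup 3))
    (Dt : ModularParametrizationData W (W.conductorNorm ℤ)) (hc : ¬ (3 : ℤ) ∣ Dt.c)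
    (hLt : (W.quadraticTwist ((-239 : ℤ) : ℚ)).entireLFunction 1 ≠ 0)
    {qd : ℚ} (hqd : haveI := isElliptic_sWd182853c1; shaAn (⟨0, 0, 1, -29817162, 125416766873⟩ : WeierstrassCurve ℚ) = (qd : ℂ)) (hvd : padicValRat 3 qd ≤ 0) :
    BSDp W 3 := by
  have hup : MissingUpperBoundAt W 3 := u1_at_182853c1 hGZ hKo hGZK hmod hGZ73 hMN hCassels hWeq hN hr Dt hc hLt hqd hvd
  subst hWeq
  have hlow : MissingLowerBoundAt (⟨0, 0, 1, -522, -9187⟩ : WeierstrassCurve ℚ) 3 :=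
    RamifiedHeegnerPairL1Intrinsic.lowerHalf_three_182853c1 hGZK hr hq hv hSel
  exact Typed.bsdp_of_missingPPartAt _ 3 hGZK hr.le (Typed.missingPPartAt_of_lower_of_upper _ 3 hlow hup)

/-! ## §5 `250065g1` = `[1, -1, 0, 310800, 51948125]`, `N = 250065 = 3^2·5·5557`, `K = ℚ(√-71)`, `Wd = [1, -1, 0, 1566741855, -18621006725854]` (`N(Wd) = 1260577665`, `∏c(Wd) = 2`, `#Wd(ℚ)_tors = 1`, `#Ш(Wd)_an = 4`; `L(E^{(-71)},1) = 0.1313356794`) -/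

/-- **THE TWIST-UNIT DATUM AT `250065g1` over `K = ℚ(√-71)`** — `SchneiderFree.Upper.TwistUnitFieldAt W 3` at `W = E`, member `W₂ = E`. KERNEL: the field
(`sqrtField (-71)`, imaginary quadratic, `d_K = -71` odd), the Heegner hypothesis at `N = 250065` (`-71 ≡ 1 (mod 8)`, `(-71/ℓ) = 1` at the odd `ℓ ∣ N`),
Kraus minimality of `Wd` (`isGloballyMinimal_sWd250065g1`, by name), the twist identity `Cd • E^{(-71)} = Wd` with `Cd = [1, -18), 1/2), 0]`. DISPLAYED: Cremona's
`N(E) = 250065` (`hN`), `L(E^{(-71)},1) = 0.1313356794 ≠ 0` (`hLt`, PARI `ellL1` = `lfun`), `#Ш(Wd)_an = 4` (`hqd`/`hvd`; g9 kit j304074, g11 TU census).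
A per-curve certificate of the research statement TU₁; nothing booked; BSD is not proved by this. [cite: KrizLi2019, Thm. 1.20]
[cite: GrossZagier1986, Thm. I.(6.3)] [cite: Cremona2006, Table 1 (Cremona label 250065g1)] -/
theorem tu_at_250065g1 {W : WeierstrassCurve ℚ} [W.IsElliptic] [W.IsGloballyMinimal] (hWeq : W = (⟨1, -1, 0, 310800, 51948125⟩ : WeierstrassCurve ℚ))
    (hN : W.conductorNorm ℤ = 250065) (hLt : (W.quadraticTwist ((-71 : ℤ) : ℚ)).entireLFunction 1 ≠ 0)
    {qd : ℚ} (hqd : haveI := isElliptic_sWd250065g1; shaAn (⟨1, -1, 0, 1566741855, -18621006725854⟩ : WeierstrassCurve ℚ) = (qd : ℂ)) (hvd : padicValRat 3 qd ≤ 0) :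
    Upper.TwistUnitFieldAt W 3 := by
  subst hWeq
  haveI := isElliptic_sWd250065g1; haveI := isGloballyMinimal_sWd250065g1
  haveI : Fact ((-71 : ℤ) < 0) := ⟨by norm_num⟩
  have hjac : ∀ ℓ : ℕ, ℓ.Prime → ℓ ∣ 250065 → ℓ ≠ 2 → jacobiSym (-71) ℓ = 1 := by
    intro ℓ hℓ hℓN hℓ2
    have hmem : ℓ ∈ Nat.primeFactors 250065 := Nat.mem_primeFactors.mpr ⟨hℓ, hℓN, by norm_num⟩
    have hpf : Nat.primeFactors 250065 = {3, 5, 5557} := by decide +kernel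
    rw [hpf] at hmem
    simp only [Finset.mem_insert, Finset.mem_singleton] at hmem
    rcases hmem with rfl | rfl | rfl
    all_goals norm_num
  have hWd : (⟨1, ((-18 : ℚ)), ((1 : ℚ)/2), (0 : ℚ)⟩ : VariableChange ℚ) •
      (⟨1, -1, 0, 310800, 51948125⟩ : WeierstrassCurve ℚ).quadraticTwist ((-71 : ℤ) : ℚ) = (⟨1, -1, 0, 1566741855, -18621006725854⟩ : WeierstrassCurve ℚ) := by
    push_cast
    ext <;> simp [WeierstrassCurve.variableChange_a₁, WeierstrassCurve.variableChange_a₂,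
      WeierstrassCurve.variableChange_a₃, WeierstrassCurve.variableChange_a₄, WeierstrassCurve.variableChange_a₆,
      WeierstrassCurve.quadraticTwist, WeierstrassCurve.b₂, WeierstrassCurve.b₄, WeierstrassCurve.b₆] <;> norm_num
  exact twistUnitFieldAt_of_sqrtField _ 3 250065 (-71) (by norm_num)
    (by rw [show (-71 : ℤ).natAbs = 71 by rfl, Nat.squarefree_iff_nodup_primeFactorsList (by norm_num)]; simp)
    hjac hN hLt _ _ hWd hqd hvd

/-- **U₁ AT `250065g1` BY THE TWIST-UNIT ROAD** — `MissingUpperBoundAt W 3` (`ord₃ #Ш(E) ≤ ord₃ #Ш(E)_an`) at `W = E` from rhp-p2 g7 §3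
`leafRankOneUpper_three_tamFree_of_print_of_twistUnit`: PRINTED binders `hGZ hKo hGZK hmod hGZ73 hMN hCassels` (Gross–Zagier ∀, Kolyvagin ∀, GZK,
Version L, GZ I.(7.3), Matar–Nekovář 2019 Thm 0.7 irreducible form, Cassels); KERNEL: `∏ c_ℓ(E) = 1` (k1 `tamagawaProduct_g250065g1` by name), `¬ CM` (`j = c₄³/Δ` is none of the
thirteen CM `j`-invariants, `hasCM_iff_j_mem_holds` + `norm_num`), `Addv ∧ SubGss` at `3` (`subGss_g250065g1_3`), and everything kernel in `tu_at_250065g1`; DISPLAYED: `hN`, `hr` (`r_an(E) = 1`, Cremona),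
the parametrisation datum `Dt` at level `N_E` with `3 ∤ c(Dt)` (`hc`; Manin constant `1` for this optimal curve, Cremona `manin.txt`), `hLt`, `hqd`/`hvd`.
NO S2, NO Σ, NO L₀, NO image hypothesis. Per curve; U₁ (26022) stays OPEN; BSD is not proved by this.
[cite: MatarNekovar2019, Thm. 0.7 (p. 456) and §0.11 (p. 457)] [cite: GrossZagier1986, Thm. I.(6.3) and (7.3)] [cite: Miller2011LMS, Def. 1.1]
[cite: Cremona2006, Table 1 (Cremona label 250065g1)] -/
theorem u1_at_250065g1
    (hGZ : ∀ (N : ℕ) [NeZero N] (W : WeierstrassCurve ℚ) (K : Type) [Field K] [NumberField K], gross_zagier N W K)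
    (hKo : ∀ (N : ℕ) [NeZero N] (W : WeierstrassCurve ℚ) (K : Type) [Field K] [NumberField K], kolyvagin N W K)
    (hGZK : rank_eq_analyticRank_of_analyticRank_le_one) (hmod : hasEntireLFunction_rat)
    (hGZ73 : GrossZagier1986_thm_I_7_3)
    (hMN : MatarNekovar2019.thm07_padicValNat_card_sha_primary_add_le_of_globalDivisibility_of_irreducible)
    (hCassels : bsdRHS_eq_of_isIsogenous)
    {W : WeierstrassCurve ℚ} [W.IsElliptic] [W.IsGloballyMinimal] (hWeq : W = (⟨1, -1, 0, 310800, 51948125⟩ : WeierstrassCurve ℚ))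
    (hN : W.conductorNorm ℤ = 250065) [NeZero (W.conductorNorm ℤ)] (hr : W.analyticRank = 1)
    (Dt : ModularParametrizationData W (W.conductorNorm ℤ)) (hc : ¬ (3 : ℤ) ∣ Dt.c)
    (hLt : (W.quadraticTwist ((-71 : ℤ) : ℚ)).entireLFunction 1 ≠ 0)
    {qd : ℚ} (hqd : haveI := isElliptic_sWd250065g1; shaAn (⟨1, -1, 0, 1566741855, -18621006725854⟩ : WeierstrassCurve ℚ) = (qd : ℂ)) (hvd : padicValRat 3 qd ≤ 0) :
    MissingUpperBoundAt W 3 := by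
  have hTU : Upper.TwistUnitFieldAt W 3 := tu_at_250065g1 hWeq hN hLt hqd hvd
  subst hWeq
  have hI : integralModelInt (⟨1, -1, 0, 310800, 51948125⟩ : WeierstrassCurve ℚ) = (⟨1, -1, 0, 310800, 51948125⟩ : WeierstrassCurve ℤ) :=
    integralModelInt_eq_of_map_eq _ (map_mk_int 1 (-1) 0 310800 51948125)
  have htam : ¬ 3 ∣ (⟨1, -1, 0, 310800, 51948125⟩ : WeierstrassCurve ℚ).tamagawaProduct := by rw [tamagawaProduct_g250065g1 hI]; norm_num
  have hCM : ¬ (⟨1, -1, 0, 310800, 51948125⟩ : WeierstrassCurve ℚ).HasCM := fun hCM ↦ by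
    have hj := (WeierstrassCurve.hasCM_iff_j_mem_holds (⟨1, -1, 0, 310800, 51948125⟩ : WeierstrassCurve ℚ)).1 hCM
    rw [WeierstrassCurve.j, Units.val_inv_eq_inv_val, WeierstrassCurve.coe_Δ'] at hj
    simp only [cmJInvariants, Finset.mem_insert, Finset.mem_singleton] at hj
    norm_num [WeierstrassCurve.Δ, WeierstrassCurve.b₂, WeierstrassCurve.b₄, WeierstrassCurve.b₆, WeierstrassCurve.b₈,
      WeierstrassCurve.c₄] at hj
  exact leafRankOneUpper_three_tamFree_of_print_of_twistUnit hGZ hKo hGZK hmod hGZ73 hMN hCassels _ hCM subGss_g250065g1_3.1 subGss_g250065g1_3.2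
    hr htam Dt hc hTU

/-- **BSD₃ AT `250065g1` modulo print and displayed numerics, by the twist-unit road** — `BSDp W 3` from `u1_at_250065g1` (upper half) and g8's LOWER half
`RamifiedHeegnerPairL1Intrinsic.lowerHalf_three_250065g1` (`9 ∣ #Ш(E)` by the rigorous 3-descent certificate `27 ∣ #Sel₃(E)`, displayed as `hSel`, with
`#Ш(E)_an = q`, `ord₃ q ≤ 2` displayed), glued by `Typed.missingPPartAt_of_lower_of_upper` + `Typed.bsdp_of_missingPPartAt` (GZK). Per curve, CONDITIONAL on
every displayed input and the seven printed facts; nothing booked; BSD is not proved by this. [cite: Miller2011LMS, Def. 1.1] [cite: SchaeferStoll2004, Cor. 5.9]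
[cite: MatarNekovar2019, Thm. 0.7 (p. 456)] [cite: Cremona2006, Table 1 (Cremona label 250065g1)] -/
theorem bsd3_at_250065g1
    (hGZ : ∀ (N : ℕ) [NeZero N] (W : WeierstrassCurve ℚ) (K : Type) [Field K] [NumberField K], gross_zagier N W K)
    (hKo : ∀ (N : ℕ) [NeZero N] (W : WeierstrassCurve ℚ) (K : Type) [Field K] [NumberField K], kolyvagin N W K)
    (hGZK : rank_eq_analyticRank_of_analyticRank_le_one) (hmod : hasEntireLFunction_rat)
    (hGZ73 : GrossZagier1986_thm_I_7_3)
    (hMN : MatarNekovar2019.thm07_padicValNat_card_sha_primary_add_le_of_globalDivisibility_of_irreducible)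
    (hCassels : bsdRHS_eq_of_isIsogenous)
    {W : WeierstrassCurve ℚ} [W.IsElliptic] [W.IsGloballyMinimal] (hWeq : W = (⟨1, -1, 0, 310800, 51948125⟩ : WeierstrassCurve ℚ))
    (hN : W.conductorNorm ℤ = 250065) [NeZero (W.conductorNorm ℤ)] (hr : W.analyticRank = 1)
    {q : ℚ} (hq : shaAn W = (q : ℂ)) (hv : padicValRat 3 q ≤ 2) (hSel : 3 ^ 3 ∣ Nat.card (W.selmerGroup 3))
    (Dt : ModularParametrizationData W (W.conductorNorm ℤ)) (hc : ¬ (3 : ℤ) ∣ Dt.c)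
    (hLt : (W.quadraticTwist ((-71 : ℤ) : ℚ)).entireLFunction 1 ≠ 0)
    {qd : ℚ} (hqd : haveI := isElliptic_sWd250065g1; shaAn (⟨1, -1, 0, 1566741855, -18621006725854⟩ : WeierstrassCurve ℚ) = (qd : ℂ)) (hvd : padicValRat 3 qd ≤ 0) :
    BSDp W 3 := by
  have hup : MissingUpperBoundAt W 3 := u1_at_250065g1 hGZ hKo hGZK hmod hGZ73 hMN hCassels hWeq hN hr Dt hc hLt hqd hvd
  subst hWeq
  have hlow : MissingLowerBoundAt (⟨1, -1, 0, 310800, 51948125⟩ : WeierstrassCurve ℚ) 3 :=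
    RamifiedHeegnerPairL1Intrinsic.lowerHalf_three_250065g1 hGZK hr hq hv hSel
  exact Typed.bsdp_of_missingPPartAt _ 3 hGZK hr.le (Typed.missingPPartAt_of_lower_of_upper _ 3 hlow hup)

end Summit.BirchSwinnertonDyer.BirchSwinnertonDyer.Theorems.RamifiedHeegnerPairTwistUnitIntrinsic

end
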